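import Summits.Ventures.LatticeQCDFlow.Scaling.ConveyorPoincareHeating
import Summits.Ventures.LatticeQCDFlow.Scaling.ReplicaExchangeBareModeBlocks
import Summits.Ventures.LatticeQCDFlow.Scaling.SimulatedTemperingModeGap

/-!
HONEST FRAMING: exact (Metropolis-corrected) sampling algorithms for lattice gauge theory; figures
of merit are autocorrelation/cost numbers at stated couplings and volumes; no continuum-physics
claim.

# ReplicaExchangeModeGapHeating — THE REPLICA-EXCHANGE MODE GAP WITHOUT THE COOLING FACTOR: ON A FINITE
# CONFIGURATION SPACE `Gap(ptBareSampler ½ μ M) ≥ p γ_A·min{δ₂/K², γ₀/(K+1)}/(256(K+1)²Π_lM_l)` — within-MODE gaps `γ_A`,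
# the HOT replica's gap BETWEEN modes `γ₀`, assignment-restricted swap overlaps `δ₂`, heating persistence `p`, and the
# one-level GROWTH bound `M` of the sector weights towards the cold end (`M = 1` when every non-trivial sector only
# decays, however fast) (lean-2 GEN-18, ours)

Venture-side (OURS).  Cell `lqcd-flow` (pub-lqcd), unit `pub-lqcd-lean-2-g18`, 2026-08-25.  The `q`-free companion
of `Scaling/ReplicaExchangeModeGap`: the same Jerrum–Son–Tetali–Vigoda decomposition of the tagless replica-exchange
sampler `P = ptBareSampler t μ M` by mode assignments (`Scaling/ReplicaExchangeBareModeBlocks`), but the projection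
chain — the label conveyor — is bounded by `Scaling/ConveyorPoincareHeating.conveyor_poincare_of_growth` (rotation
paths) instead of `Scaling/ConveyorPoincare.conveyor_poincare_of_cooling` (bubbling paths).  The cooling ratio `q`
(`q·ν_l(j) ≤ ν_{l+1}(j)`, whose `K`-th power is the full hot-to-cold suppression of the rarest sector) is replaced
by the levelwise growth bounds `M_l ≥ 1` (`ν_{l+1}(j) ≤ M_l·ν_l(j)`): sectors that become RARE towards the cold end —
the non-trivial topological sectors at fine lattice spacing — cost nothing; only sectors that GAIN weight enter,
through `Π_l M_l` (= `ν_K(0)/ν_0(0) ≤ 1/ν_0(0)` when the trivial sector `0` is the only one that gains).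

## What is proved (finite-chain vocabulary of `Literature.Probability.MarkovChains`)

* §1 **`ptBareModeRot_projection_poincare`** — `C·Var_π̄ ≤ 𝓔_π̄(P̄)` for the mode-assignment projection chain and
  every `C ≥ 0` with `C·16K²(K+1)Π_lM_l ≤ p tδ₂` and `C·16(K+1)² ≤ p γ₀(1−t)`.
* §2 **`ptBareModeRot_spectralGap_ge`** — JSTV: `Gap(P) ≥ min{C/3, C·λ_A/(3 + C)}`, `λ_A = (1−t)γ_A/(K+1)`.
* §3 `t = ½`, `p, δ₂, γ_A ≤ 1 ≤ M_l`, `K ≥ 1`: **`ptBareModeRotHalf_spectralGap_ge`** —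
  `Gap ≥ p γ_A·min{δ₂/K², γ₀/(K+1)}/(256(K+1)²Π_lM_l)`, and **`ptBareModeRotHalf_spectralGap_ge_of_hotGap`** (the hot
  replica's GLOBAL gap in place of its mode-projection gap).
* §4 MONOTONE SECTOR LADDERS (`b_l(j) = blockMass (μ l) mode j` non-increasing in `l` for every `j ≠ j₀`, non-decreasing
  for `j₀` — every non-trivial sector only gets rarer towards the cold end, the trivial sector `j₀` absorbs the
  weight): `prod_succ_div_castSucc` (telescoping `Π_l b(l+1)/b(l) = b(K)/b(0)`) and
  **`ptBareMonotoneHalf_spectralGap_ge`** — `Gap(ptBareSampler ½ μ M) ≥ b_0(j₀)²·γ_A·min{δ₂/K², γ₀/(K+1)}/(256(K+1)²)`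
  (`p = b_0(j₀)`, `M_l = b_{l+1}(j₀)/b_l(j₀)`, `Π_l M_l ≤ 1/b_0(j₀)`): THE ONLY LADDER-SHAPE INPUT IS THE HOT MASS OF THE
  GAINING SECTOR; **`ptBareMonotoneHalf_spectralGap_ge_of_hotGap`**.

NOT CLAIMED: several gaining sectors in closed form (use §3 with `M_l = max_j b_{l+1}(j)/b_l(j)`); the `τ_int` /
asymptotic-variance / mixing-time corollaries (verbatim as in `Scaling/ReplicaExchangeModeGap`
§4 and `Scaling/ReplicaExchangeModeMixingTime` with the new constant); sharp constants; anything measured.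
Literature grade (cell rule): KNOWN MECHANISM (Jerrum–Son–Tetali–Vigoda 2004; comparison paths), NEW RESULT (the
`q`-free explicit constant for the exact finite sampler); nothing cited as a fact; no new bib keys.
-/

noncomputable section

open Finset Function
open Literature.Probability.MarkovChains
open Literature.Probability.MarkovChains.Decomposition

namespace Summit.Ventures.LatticeQCDFlow.Scaling

section ModeGapHeating

variable {S J : Type*} [Fintype S] [DecidableEq S] [Fintype J] [DecidableEq J] {K : ℕ}
  {μ : Fin (K + 1) → S → ℝ} (hμ : ∀ k x, 0 < μ k x) (hμ1 : ∀ k, ∑ x, μ k x = 1)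
  {M : Fin (K + 1) → S → S → ℝ} {mode : S → J} (hmode : Function.Surjective mode) {t : ℝ}

/-! ## §1 The projection chain: the conveyor along rotation paths -/

include hμ hμ1 hmode in
/-- **THE PROJECTION CHAIN'S POINCARÉ CONSTANT WITHOUT COOLING** (conveyor with `κ = tδ₂/K`, `ρ = γ₀`,
`θ = (1−t)/(K+1)`, block-heating factor `Π_l M_l`): for every `C ≥ 0` with `C·16K²(K+1)Π_l M_l ≤ p tδ₂` and
`C·16(K+1)² ≤ p γ₀(1−t)`, `C·Var_π̄(g) ≤ 𝓔_π̄(P̄; g)`. [ours] -/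
theorem ptBareModeRot_projection_poincare (hK : 1 ≤ K) (hM : ∀ k, IsRowStochastic (M k)) (ht0 : 0 < t)
    (ht1 : t < 1) {p δ₂ γ₀ : ℝ} {Mg : Fin K → ℝ} (hp : 0 < p) (hMg : ∀ l, 1 ≤ Mg l) (hδ0 : 0 < δ₂) (hγ₀ : 0 < γ₀)
    (hpers : ∀ (i k : Fin (K + 1)) (j : J), i ≤ k → p * blockMass (μ k) mode j ≤ blockMass (μ i) mode j)
    (hgrow : ∀ (l : Fin K) (j : J), blockMass (μ l.succ) mode j ≤ Mg l * blockMass (μ l.castSucc) mode j)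
    (hδ : ∀ (m : Fin (K + 1) → J) (l : Fin K), m ∘ levelSwap l ≠ m →
      δ₂ * min (blockMass (tensorFun μ) (fun z : Fin (K + 1) → S => mode ∘ z) m)
          (blockMass (tensorFun μ) (fun z : Fin (K + 1) → S => mode ∘ z) (m ∘ levelSwap l))
        ≤ ∑ x ∈ block (fun z : Fin (K + 1) → S => mode ∘ z) m, min (tensorFun μ x) (tensorFun μ (x ∘ levelSwap l)))
    (hgap0 : ∀ h : J → ℝ, γ₀ * lawVariance (blockMass (μ 0) mode) h
      ≤ dirichletForm (blockMass (μ 0) mode) (projectionChain (μ 0) (M 0) mode) h)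
    {C : ℝ} (hC0 : 0 ≤ C) (hC1 : C * (16 * K ^ 2 * (K + 1) * (∏ l, Mg l)) ≤ p * (t * δ₂))
    (hC2 : C * (16 * (K + 1) ^ 2) ≤ p * γ₀ * (1 - t)) (g : (Fin (K + 1) → J) → ℝ) :
    C * lawVariance (blockMass (tensorFun μ) (fun z : Fin (K + 1) → S => mode ∘ z)) g
      ≤ dirichletForm (blockMass (tensorFun μ) (fun z : Fin (K + 1) → S => mode ∘ z))
          (projectionChain (tensorFun μ) (ptBareSampler t μ M) (fun z : Fin (K + 1) → S => mode ∘ z)) g := by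
  have hlaw : blockMass (tensorFun μ) (fun z : Fin (K + 1) → S => mode ∘ z)
      = tensorFun (fun k => blockMass (μ k) mode) := funext ptBareMode_blockMass
  have hKr : (1 : ℝ) ≤ K := by exact_mod_cast hK
  have hK0 : (0 : ℝ) < K := by linarith
  have hP := ptBareSampler_isRowStochastic (M := M) hμ hM ht0.le ht1.le
  rw [hlaw]
  refine conveyor_poincare_of_levelGrowth (ν := fun k => blockMass (μ k) mode)
    (Q := projectionChain (tensorFun μ) (ptBareSampler t μ M) (fun z : Fin (K + 1) → S => mode ∘ z))
    (fun k j => blockMass_nonneg (fun x => (hμ k x).le) mode j)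
    (fun k => by rw [sum_blockMass, hμ1 k]) hp hMg (by positivity : 0 < t * δ₂ / K) hγ₀
    (by apply div_pos (by linarith) (by positivity) : (0 : ℝ) < (1 - t) / (K + 1)) hpers hgrow
    (projectionChain_nonneg (fun x => (tensorFun_pos hμ x).le) hP.1 _) ?_ hgap0 ?_ g hC0 ?_ ?_
  · -- transposition flows
    intro z l hzl
    have h := ptBareMode_proj_swap (M := M) hμ hmode hM ht0.le ht1.le hδ z l hzl
    rw [hlaw] at h
    exact h
  · -- hot relabels
    intro z v hv
    exact ptBareMode_proj_relabel (M := M) hμ hmode hM ht0.le ht1.le z v hv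
  · -- `C·16K(K+1)Π M_l ≤ p (tδ₂/K)`
    rw [show p * (t * δ₂ / K) = p * (t * δ₂) / K by ring, le_div_iff₀ hK0]
    calc C * (16 * K * (K + 1) * (∏ l, Mg l)) * K = C * (16 * K ^ 2 * (K + 1) * (∏ l, Mg l)) := by ring
      _ ≤ p * (t * δ₂) := hC1
  · -- `C·16(K+1) ≤ p γ₀ (1−t)/(K+1)`
    rw [show p * γ₀ * ((1 - t) / (K + 1)) = p * γ₀ * (1 - t) / (K + 1) by ring,
      le_div_iff₀ (by positivity)]
    calc C * (16 * (K + 1)) * (K + 1) = C * (16 * (K + 1) ^ 2) := by ring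
      _ ≤ p * γ₀ * (1 - t) := hC2

/-! ## §2 The spectral gap -/

include hμ hμ1 hmode in
/-- **THE SPECTRAL GAP WITHOUT THE COOLING FACTOR** (Jerrum–Son–Tetali–Vigoda Theorem 1 with mode assignments as
blocks): `Gap(ptBareSampler t μ M) ≥ min{C/3, C·λ_A/(3 + C)}`, `λ_A = (1−t)γ_A/(K+1)`, for every `C > 0` with
`C·16K²(K+1)Π_l M_l ≤ p tδ₂`, `C·16(K+1)² ≤ p γ₀(1−t)`. [ours] -/
theorem ptBareModeRot_spectralGap_ge [Nontrivial S] (hK : 1 ≤ K) (hM : ∀ k, IsRowStochastic (M k))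
    (hMrev : ∀ k, DetailedBalance (μ k) (M k)) (ht0 : 0 < t) (ht1 : t < 1)
    {p δ₂ γ₀ γA : ℝ} {Mg : Fin K → ℝ} (hp : 0 < p) (hMg : ∀ l, 1 ≤ Mg l) (hδ0 : 0 < δ₂) (hγ₀ : 0 < γ₀)
    (hγA : 0 < γA)
    (hpers : ∀ (i k : Fin (K + 1)) (j : J), i ≤ k → p * blockMass (μ k) mode j ≤ blockMass (μ i) mode j)
    (hgrow : ∀ (l : Fin K) (j : J), blockMass (μ l.succ) mode j ≤ Mg l * blockMass (μ l.castSucc) mode j)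
    (hδ : ∀ (m : Fin (K + 1) → J) (l : Fin K), m ∘ levelSwap l ≠ m →
      δ₂ * min (blockMass (tensorFun μ) (fun z : Fin (K + 1) → S => mode ∘ z) m)
          (blockMass (tensorFun μ) (fun z : Fin (K + 1) → S => mode ∘ z) (m ∘ levelSwap l))
        ≤ ∑ x ∈ block (fun z : Fin (K + 1) → S => mode ∘ z) m, min (tensorFun μ x) (tensorFun μ (x ∘ levelSwap l)))
    (hgap0 : ∀ h : J → ℝ, γ₀ * lawVariance (blockMass (μ 0) mode) h
      ≤ dirichletForm (blockMass (μ 0) mode) (projectionChain (μ 0) (M 0) mode) h)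
    (hgapA : ∀ k j, ∀ h : S → ℝ, γA * lawVariance (blockLaw (μ k) mode j) h
      ≤ dirichletForm (blockLaw (μ k) mode j) (restrictionChain (M k) mode) h)
    {C : ℝ} (hC0 : 0 < C) (hC1 : C * (16 * K ^ 2 * (K + 1) * (∏ l, Mg l)) ≤ p * (t * δ₂))
    (hC2 : C * (16 * (K + 1) ^ 2) ≤ p * γ₀ * (1 - t)) :
    min (C / 3) (C * ((1 - t) * γA / (K + 1)) / (3 * 1 + C))
      ≤ spectralGap (tensorFun μ) (ptBareSampler t μ M) := by
  have hP := ptBareSampler_isRowStochastic (M := M) hμ hM ht0.le ht1.le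
  exact JerrumEtAl2004_thm_1_spectralGap (tensorFun_pos hμ) (sum_tensorFun_eq_one μ hμ1)
    hP (ptBareSampler_detailedBalance hμ hMrev)
    (modes_surjective hmode) hC0 (by apply div_pos (mul_pos (by linarith) hγA) (by positivity)) zero_le_one
    (ptBareModeRot_projection_poincare hμ hμ1 hmode hK hM ht0 ht1 hp hMg hδ0 hγ₀ hpers hgrow hδ hgap0 hC0.le
      hC1 hC2)
    (fun m f => ptBareMode_restriction_poincare hμ hmode hM ht0.le ht1.le hgapA m f)
    (fun x => (escapeProb_le_escapeParameter _ _ x).trans (escapeParameter_le_one hP _))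

/-! ## §3 The half-half scan in closed form -/

include hμ hμ1 hmode in
/-- **`t = ½`: `Gap ≥ p γ_A·min{δ₂/K², γ₀/(K+1)}/(256(K+1)²Π_l M_l)`** (`p, δ₂, γ_A ≤ 1 ≤ M_l`, `K ≥ 1`) — no cooling
factor. [ours] -/
theorem ptBareModeRotHalf_spectralGap_ge [Nontrivial S] (hK : 1 ≤ K) (hM : ∀ k, IsRowStochastic (M k))
    (hMrev : ∀ k, DetailedBalance (μ k) (M k))
    {p δ₂ γ₀ γA : ℝ} {Mg : Fin K → ℝ} (hp : 0 < p) (hp1 : p ≤ 1) (hMg : ∀ l, 1 ≤ Mg l) (hδ0 : 0 < δ₂)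
    (hδ1 : δ₂ ≤ 1)
    (hγ₀ : 0 < γ₀) (hγA : 0 < γA) (hγA1 : γA ≤ 1)
    (hpers : ∀ (i k : Fin (K + 1)) (j : J), i ≤ k → p * blockMass (μ k) mode j ≤ blockMass (μ i) mode j)
    (hgrow : ∀ (l : Fin K) (j : J), blockMass (μ l.succ) mode j ≤ Mg l * blockMass (μ l.castSucc) mode j)
    (hδ : ∀ (m : Fin (K + 1) → J) (l : Fin K), m ∘ levelSwap l ≠ m →
      δ₂ * min (blockMass (tensorFun μ) (fun z : Fin (K + 1) → S => mode ∘ z) m)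
          (blockMass (tensorFun μ) (fun z : Fin (K + 1) → S => mode ∘ z) (m ∘ levelSwap l))
        ≤ ∑ x ∈ block (fun z : Fin (K + 1) → S => mode ∘ z) m, min (tensorFun μ x) (tensorFun μ (x ∘ levelSwap l)))
    (hgap0 : ∀ h : J → ℝ, γ₀ * lawVariance (blockMass (μ 0) mode) h
      ≤ dirichletForm (blockMass (μ 0) mode) (projectionChain (μ 0) (M 0) mode) h)
    (hgapA : ∀ k j, ∀ h : S → ℝ, γA * lawVariance (blockLaw (μ k) mode j) h
      ≤ dirichletForm (blockLaw (μ k) mode j) (restrictionChain (M k) mode) h) :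
    p * γA * min (δ₂ / K ^ 2) (γ₀ / (K + 1)) / (256 * (K + 1) ^ 2 * (∏ l, Mg l))
      ≤ spectralGap (tensorFun μ) (ptBareSampler (1 / 2) μ M) := by
  have hKr : (1 : ℝ) ≤ K := by exact_mod_cast hK
  have hK0 : (0 : ℝ) < K := by linarith
  have hK2 : (1 : ℝ) ≤ (K : ℝ) ^ 2 := by nlinarith
  have hMK0 : 0 < (∏ l, Mg l) := prod_pos fun l _ => lt_of_lt_of_le one_pos (hMg l)
  have hMK : 1 ≤ (∏ l, Mg l) := by
    calc (1 : ℝ) = ∏ _l : Fin K, (1 : ℝ) := by simp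
      _ ≤ ∏ l, Mg l := prod_le_prod (fun _ _ => zero_le_one) fun l _ => hMg l
  set m₀ := min (δ₂ / K ^ 2) (γ₀ / (K + 1)) with hm₀
  have hm₀pos : 0 < m₀ := lt_min (div_pos hδ0 (by positivity)) (div_pos hγ₀ (by positivity))
  have hm₀le : m₀ ≤ 1 := by
    have h1 : m₀ ≤ δ₂ / K ^ 2 := min_le_left _ _
    have h2 : δ₂ / K ^ 2 ≤ 1 := by rw [div_le_one (by positivity)]; exact hδ1.trans hK2
    exact h1.trans h2
  -- the admissible constant `C = p m₀/(32(K+1)Π M_l)`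
  set C := p * m₀ / (32 * (K + 1) * (∏ l, Mg l)) with hC
  have hCpos : 0 < C := by positivity
  have hC1 : C * (16 * K ^ 2 * (K + 1) * (∏ l, Mg l)) ≤ p * ((1 / 2 : ℝ) * δ₂) := by
    have h1 : m₀ * K ^ 2 ≤ δ₂ := by
      have := min_le_left (δ₂ / K ^ 2) (γ₀ / (K + 1))
      rw [← hm₀] at this
      calc m₀ * K ^ 2 ≤ δ₂ / K ^ 2 * K ^ 2 := mul_le_mul_of_nonneg_right this (by positivity)
        _ = δ₂ := div_mul_cancel₀ δ₂ (by positivity)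
    have e : C * (16 * K ^ 2 * (K + 1) * (∏ l, Mg l)) = p * (m₀ * K ^ 2) / 2 := by
      rw [hC]; field_simp; norm_num
    rw [e]
    have : p * (m₀ * K ^ 2) ≤ p * δ₂ := mul_le_mul_of_nonneg_left h1 hp.le
    linarith
  have hC2 : C * (16 * (K + 1) ^ 2) ≤ p * γ₀ * (1 - 1 / 2) := by
    have h1 : m₀ * (K + 1) ≤ γ₀ := by
      have := min_le_right (δ₂ / K ^ 2) (γ₀ / (K + 1))
      rw [← hm₀] at this
      calc m₀ * (K + 1) ≤ γ₀ / (K + 1) * (K + 1) := mul_le_mul_of_nonneg_right this (by positivity)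
        _ = γ₀ := div_mul_cancel₀ γ₀ (by positivity)
    have e : C * (16 * (K + 1) ^ 2) = p * (m₀ * (K + 1)) / (2 * (∏ l, Mg l)) := by
      rw [hC]; field_simp; norm_num
    rw [e, div_le_iff₀ (by positivity)]
    have h2 : p * (m₀ * (K + 1)) ≤ p * γ₀ := mul_le_mul_of_nonneg_left h1 hp.le
    have h3 : p * γ₀ * (1 - 1 / 2) * (2 * (∏ l, Mg l)) = p * γ₀ * (∏ l, Mg l) := by ring
    rw [h3]
    calc p * (m₀ * (K + 1)) ≤ p * γ₀ := h2
      _ = p * γ₀ * 1 := (mul_one _).symm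
      _ ≤ p * γ₀ * (∏ l, Mg l) := mul_le_mul_of_nonneg_left hMK (by positivity)
  have key := ptBareModeRot_spectralGap_ge hμ hμ1 hmode hK hM hMrev (by norm_num : (0 : ℝ) < 1 / 2)
    (by norm_num : (1 / 2 : ℝ) < 1) hp hMg hδ0 hγ₀ hγA hpers hgrow hδ hgap0 hgapA hCpos hC1 hC2
  refine le_trans ?_ key
  -- `C ≤ 1/64`, so `min{C/3, C·(γ_A/(2(K+1)))/(3 + C)} ≥ Cγ_A/(8(K+1)) = p γ_A m₀/(256(K+1)²Π_lM_l)`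
  have hCle : C ≤ 1 / 64 := by
    rw [hC, div_le_iff₀ (by positivity)]
    have h2 : p * m₀ ≤ 1 := by nlinarith
    have hK1 : (2 : ℝ) ≤ K + 1 := by linarith
    nlinarith
  have hval : p * γA * m₀ / (256 * (K + 1) ^ 2 * (∏ l, Mg l)) = C * γA / (8 * (K + 1)) := by
    rw [hC]
    field_simp
    norm_num
  rw [hval]
  refine le_min ?_ ?_
  · -- `CγA/(8(K+1)) ≤ C/3`
    rw [div_le_div_iff₀ (by positivity) (by norm_num)]
    have : γA * 3 ≤ 8 * (K + 1) := by nlinarith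
    nlinarith [mul_le_mul_of_nonneg_left this hCpos.le]
  · -- `CγA/(8(K+1)) ≤ C((1/2)γA/(K+1))/(3 + C)`
    rw [show (1 : ℝ) - 1 / 2 = 1 / 2 by norm_num]
    rw [show C * (1 / 2 * γA / (K + 1)) / (3 * 1 + C) = C * γA / (2 * (K + 1) * (3 + C)) by
      field_simp]
    rw [div_le_div_iff₀ (by positivity) (by positivity)]
    have h3 : 2 * (K + 1) * (3 + C) ≤ 8 * (K + 1) := by nlinarith
    exact mul_le_mul_of_nonneg_left h3 (by positivity)

include hμ hμ1 hmode in
/-- **The same with the hot replica's GLOBAL gap** (`γ₀·Var_{μ_0} ≤ 𝓔_{μ_0}(M_0)` passes to the mode projection by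
`Scaling/SimulatedTemperingModeGap.projection_poincare_of_poincare`). [ours] -/
theorem ptBareModeRotHalf_spectralGap_ge_of_hotGap [Nontrivial S] (hK : 1 ≤ K) (hM : ∀ k, IsRowStochastic (M k))
    (hMrev : ∀ k, DetailedBalance (μ k) (M k))
    {p δ₂ γ₀ γA : ℝ} {Mg : Fin K → ℝ} (hp : 0 < p) (hp1 : p ≤ 1) (hMg : ∀ l, 1 ≤ Mg l) (hδ0 : 0 < δ₂)
    (hδ1 : δ₂ ≤ 1)
    (hγ₀ : 0 < γ₀) (hγA : 0 < γA) (hγA1 : γA ≤ 1)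
    (hpers : ∀ (i k : Fin (K + 1)) (j : J), i ≤ k → p * blockMass (μ k) mode j ≤ blockMass (μ i) mode j)
    (hgrow : ∀ (l : Fin K) (j : J), blockMass (μ l.succ) mode j ≤ Mg l * blockMass (μ l.castSucc) mode j)
    (hδ : ∀ (m : Fin (K + 1) → J) (l : Fin K), m ∘ levelSwap l ≠ m →
      δ₂ * min (blockMass (tensorFun μ) (fun z : Fin (K + 1) → S => mode ∘ z) m)
          (blockMass (tensorFun μ) (fun z : Fin (K + 1) → S => mode ∘ z) (m ∘ levelSwap l))
        ≤ ∑ x ∈ block (fun z : Fin (K + 1) → S => mode ∘ z) m, min (tensorFun μ x) (tensorFun μ (x ∘ levelSwap l)))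
    (hgap0 : ∀ h : S → ℝ, γ₀ * lawVariance (μ 0) h ≤ dirichletForm (μ 0) (M 0) h)
    (hgapA : ∀ k j, ∀ h : S → ℝ, γA * lawVariance (blockLaw (μ k) mode j) h
      ≤ dirichletForm (blockLaw (μ k) mode j) (restrictionChain (M k) mode) h) :
    p * γA * min (δ₂ / K ^ 2) (γ₀ / (K + 1)) / (256 * (K + 1) ^ 2 * (∏ l, Mg l))
      ≤ spectralGap (tensorFun μ) (ptBareSampler (1 / 2) μ M) :=
  ptBareModeRotHalf_spectralGap_ge hμ hμ1 hmode hK hM hMrev hp hp1 hMg hδ0 hδ1 hγ₀ hγA hγA1 hpers hgrow hδ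
    (projection_poincare_of_poincare (fun j => (blockMass_pos (hμ 0) hmode j).ne') hgap0) hgapA

/-! ## §4 Monotone sector ladders: the only ladder input is the hot mass of the gaining sector -/

omit [Fintype S] [DecidableEq S] [Fintype J] [DecidableEq J] in
/-- **Telescoping along the ladder:** `Π_l b(l+1)/b(l) = b(K)/b(0)` for positive `b`. [folklore] -/
theorem prod_succ_div_castSucc {b : Fin (K + 1) → ℝ} (hb : ∀ k, 0 < b k) :
    ∏ l : Fin K, b l.succ / b l.castSucc = b (Fin.last K) / b 0 := by
  have hP : 0 < ∏ k : Fin (K + 1), b k := prod_pos fun k _ => hb k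
  have h1 : ∏ k : Fin (K + 1), b k = b 0 * ∏ l : Fin K, b l.succ := Fin.prod_univ_succ _
  have h2 : ∏ k : Fin (K + 1), b k = (∏ l : Fin K, b l.castSucc) * b (Fin.last K) := Fin.prod_univ_castSucc _
  have hc : 0 < ∏ l : Fin K, b l.castSucc := prod_pos fun l _ => hb _
  rw [prod_div_distrib, div_eq_div_iff hc.ne' (hb 0).ne']
  have e1 : ∏ l : Fin K, b l.succ = (∏ k : Fin (K + 1), b k) / b 0 := by
    rw [h1, mul_div_cancel_left₀ _ (hb 0).ne']
  have e2 : ∏ l : Fin K, b l.castSucc = (∏ k : Fin (K + 1), b k) / b (Fin.last K) := by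
    rw [h2, mul_div_cancel_right₀ _ (hb _).ne']
  rw [e1, e2, div_mul_cancel₀ _ (hb 0).ne', mul_comm, div_mul_cancel₀ _ (hb (Fin.last K)).ne']

include hμ hμ1 hmode in
/-- **THE MODE GAP ON A MONOTONE SECTOR LADDER:** if `b_l(j) = blockMass (μ l) mode j` is non-increasing in `l` for
every `j ≠ j₀` and non-decreasing for `j₀`, then
`Gap(ptBareSampler ½ μ M) ≥ b_0(j₀)²·γ_A·min{δ₂/K², γ₀/(K+1)}/(256(K+1)²)`. [ours] -/
theorem ptBareMonotoneHalf_spectralGap_ge [Nontrivial S] (hK : 1 ≤ K) (hM : ∀ k, IsRowStochastic (M k))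
    (hMrev : ∀ k, DetailedBalance (μ k) (M k)) (j₀ : J)
    (hdec : ∀ j, j ≠ j₀ → ∀ l : Fin K, blockMass (μ l.succ) mode j ≤ blockMass (μ l.castSucc) mode j)
    (hinc : ∀ l : Fin K, blockMass (μ l.castSucc) mode j₀ ≤ blockMass (μ l.succ) mode j₀)
    {δ₂ γ₀ γA : ℝ} (hδ0 : 0 < δ₂) (hδ1 : δ₂ ≤ 1) (hγ₀ : 0 < γ₀) (hγA : 0 < γA) (hγA1 : γA ≤ 1)
    (hδ : ∀ (m : Fin (K + 1) → J) (l : Fin K), m ∘ levelSwap l ≠ m →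
      δ₂ * min (blockMass (tensorFun μ) (fun z : Fin (K + 1) → S => mode ∘ z) m)
          (blockMass (tensorFun μ) (fun z : Fin (K + 1) → S => mode ∘ z) (m ∘ levelSwap l))
        ≤ ∑ x ∈ block (fun z : Fin (K + 1) → S => mode ∘ z) m, min (tensorFun μ x) (tensorFun μ (x ∘ levelSwap l)))
    (hgap0 : ∀ h : J → ℝ, γ₀ * lawVariance (blockMass (μ 0) mode) h
      ≤ dirichletForm (blockMass (μ 0) mode) (projectionChain (μ 0) (M 0) mode) h)
    (hgapA : ∀ k j, ∀ h : S → ℝ, γA * lawVariance (blockLaw (μ k) mode j) h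
      ≤ dirichletForm (blockLaw (μ k) mode j) (restrictionChain (M k) mode) h) :
    (blockMass (μ 0) mode j₀) ^ 2 * γA * min (δ₂ / K ^ 2) (γ₀ / (K + 1)) / (256 * (K + 1) ^ 2)
      ≤ spectralGap (tensorFun μ) (ptBareSampler (1 / 2) μ M) := by
  -- the sector weights
  set b : Fin (K + 1) → J → ℝ := fun l j => blockMass (μ l) mode j with hb
  have hbpos : ∀ l j, 0 < b l j := fun l j => blockMass_pos (hμ l) hmode j
  have hble : ∀ l j, b l j ≤ 1 := by
    intro l j
    calc b l j ≤ ∑ i, b l i := single_le_sum (fun i _ => (hbpos l i).le) (mem_univ j)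
      _ = 1 := by simp only [hb]; rw [sum_blockMass, hμ1 l]
  -- monotonicity along the ladder
  have hanti : ∀ j, j ≠ j₀ → Antitone (fun l => b l j) := fun j hj =>
    Fin.antitone_iff_succ_le.mpr fun l => hdec j hj l
  have hmono : Monotone (fun l => b l j₀) := Fin.monotone_iff_le_succ.mpr fun l => hinc l
  -- heating persistence `p = b_0(j₀)`
  set p := b 0 j₀ with hp
  have hp0 : 0 < p := hbpos 0 j₀
  have hp1 : p ≤ 1 := hble 0 j₀
  have hpers : ∀ (i k : Fin (K + 1)) (j : J), i ≤ k → p * blockMass (μ k) mode j ≤ blockMass (μ i) mode j := by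
    intro i k j hik
    change p * b k j ≤ b i j
    by_cases hj : j = j₀
    · subst hj
      calc p * b k j ≤ p * 1 := mul_le_mul_of_nonneg_left (hble k j) hp0.le
        _ = b 0 j := mul_one _
        _ ≤ b i j := hmono (Fin.zero_le i)
    · calc p * b k j ≤ 1 * b k j := mul_le_mul_of_nonneg_right hp1 (hbpos k j).le
        _ = b k j := one_mul _
        _ ≤ b i j := hanti j hj hik
  -- levelwise growth `M_l = b_{l+1}(j₀)/b_l(j₀)`
  set Mg : Fin K → ℝ := fun l => b l.succ j₀ / b l.castSucc j₀ with hMg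
  have hMg1 : ∀ l, 1 ≤ Mg l := fun l => by
    rw [hMg, le_div_iff₀ (hbpos _ _), one_mul]; exact hinc l
  have hgrow : ∀ (l : Fin K) (j : J), blockMass (μ l.succ) mode j ≤ Mg l * blockMass (μ l.castSucc) mode j := by
    intro l j
    change b l.succ j ≤ Mg l * b l.castSucc j
    by_cases hj : j = j₀
    · subst hj
      rw [hMg, div_mul_cancel₀ _ (hbpos _ _).ne']
    · calc b l.succ j ≤ b l.castSucc j := hdec j hj l
        _ = 1 * b l.castSucc j := (one_mul _).symm
        _ ≤ Mg l * b l.castSucc j := mul_le_mul_of_nonneg_right (hMg1 l) (hbpos _ _).le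
  have hprod : ∏ l, Mg l = b (Fin.last K) j₀ / b 0 j₀ :=
    prod_succ_div_castSucc (b := fun l => b l j₀) fun l => hbpos l j₀
  have hprod_le : ∏ l, Mg l ≤ 1 / p := by
    rw [hprod, hp]
    exact div_le_div_of_nonneg_right (hble _ _) (hbpos 0 j₀).le
  have hprod_pos : 0 < ∏ l, Mg l := prod_pos fun l _ => lt_of_lt_of_le one_pos (hMg1 l)
  have key := ptBareModeRotHalf_spectralGap_ge hμ hμ1 hmode hK hM hMrev hp0 hp1 hMg1 hδ0 hδ1 hγ₀ hγA hγA1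
    hpers hgrow hδ hgap0 hgapA
  refine le_trans ?_ key
  -- `b₀² X/(256(K+1)²) ≤ p X/(256(K+1)² Π M)` since `Π M ≤ 1/p`
  have hX : 0 ≤ γA * min (δ₂ / K ^ 2) (γ₀ / (K + 1)) :=
    mul_nonneg hγA.le (le_min (div_nonneg hδ0.le (by positivity)) (div_nonneg hγ₀.le (by positivity)))
  rw [div_le_div_iff₀ (by positivity) (by positivity)]
  have h1 : p ^ 2 * (∏ l, Mg l) ≤ p := by
    calc p ^ 2 * (∏ l, Mg l) ≤ p ^ 2 * (1 / p) := mul_le_mul_of_nonneg_left hprod_le (by positivity)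
      _ = p := by rw [pow_two, mul_one_div, mul_div_assoc, div_self hp0.ne', mul_one]
  calc p ^ 2 * γA * min (δ₂ / K ^ 2) (γ₀ / (K + 1)) * (256 * (K + 1) ^ 2 * ∏ l, Mg l)
      = (p ^ 2 * ∏ l, Mg l) * (γA * min (δ₂ / K ^ 2) (γ₀ / (K + 1))) * (256 * (K + 1) ^ 2) := by ring
    _ ≤ p * (γA * min (δ₂ / K ^ 2) (γ₀ / (K + 1))) * (256 * (K + 1) ^ 2) :=
        mul_le_mul_of_nonneg_right (mul_le_mul_of_nonneg_right h1 hX) (by positivity)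
    _ = p * γA * min (δ₂ / K ^ 2) (γ₀ / (K + 1)) * (256 * (K + 1) ^ 2) := by ring

include hμ hμ1 hmode in
/-- **The same with the hot replica's GLOBAL gap** `γ₀·Var_{μ_0} ≤ 𝓔_{μ_0}(M_0)`. [ours] -/
theorem ptBareMonotoneHalf_spectralGap_ge_of_hotGap [Nontrivial S] (hK : 1 ≤ K) (hM : ∀ k, IsRowStochastic (M k))
    (hMrev : ∀ k, DetailedBalance (μ k) (M k)) (j₀ : J)
    (hdec : ∀ j, j ≠ j₀ → ∀ l : Fin K, blockMass (μ l.succ) mode j ≤ blockMass (μ l.castSucc) mode j)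
    (hinc : ∀ l : Fin K, blockMass (μ l.castSucc) mode j₀ ≤ blockMass (μ l.succ) mode j₀)
    {δ₂ γ₀ γA : ℝ} (hδ0 : 0 < δ₂) (hδ1 : δ₂ ≤ 1) (hγ₀ : 0 < γ₀) (hγA : 0 < γA) (hγA1 : γA ≤ 1)
    (hδ : ∀ (m : Fin (K + 1) → J) (l : Fin K), m ∘ levelSwap l ≠ m →
      δ₂ * min (blockMass (tensorFun μ) (fun z : Fin (K + 1) → S => mode ∘ z) m)
          (blockMass (tensorFun μ) (fun z : Fin (K + 1) → S => mode ∘ z) (m ∘ levelSwap l))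
        ≤ ∑ x ∈ block (fun z : Fin (K + 1) → S => mode ∘ z) m, min (tensorFun μ x) (tensorFun μ (x ∘ levelSwap l)))
    (hgap0 : ∀ h : S → ℝ, γ₀ * lawVariance (μ 0) h ≤ dirichletForm (μ 0) (M 0) h)
    (hgapA : ∀ k j, ∀ h : S → ℝ, γA * lawVariance (blockLaw (μ k) mode j) h
      ≤ dirichletForm (blockLaw (μ k) mode j) (restrictionChain (M k) mode) h) :
    (blockMass (μ 0) mode j₀) ^ 2 * γA * min (δ₂ / K ^ 2) (γ₀ / (K + 1)) / (256 * (K + 1) ^ 2)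
      ≤ spectralGap (tensorFun μ) (ptBareSampler (1 / 2) μ M) :=
  ptBareMonotoneHalf_spectralGap_ge hμ hμ1 hmode hK hM hMrev j₀ hdec hinc hδ0 hδ1 hγ₀ hγA hγA1 hδ
    (projection_poincare_of_poincare (fun j => (blockMass_pos (hμ 0) hmode j).ne') hgap0) hgapA

end ModeGapHeating

end Summit.Ventures.LatticeQCDFlow.Scaling
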